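import Literature.MathematicalPhysics.QuantumFieldTheory.LatticeGaugeProofs
import HarnessLib

/-!
# Route `LangevinControlUV`, crux `FemtoCurvatureTwoPointC` (stmt-QuantumFields-16204), line `birth` —
# the top-link assignment on the 4-torus

Registered wave-3 sub-goal `torus_topLink_assignment` (`--supports stmt-QuantumFields-16204`), proved
verbatim. It is the purely combinatorial input of the torus partition-function UPPER bound: to bound
`Z_L(β) = ∫ ∏ₚ e^{−β Pₚ}` above one integrates the links of the torus `(ℤ/L)⁴` out one at a time, from the
highest *rank* down, and a plaquette `p` of a chosen family `P` contributes one factor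
`z(β) = ∫ e^{−βP} ≤ C β^{−D/2}` provided its top-ranked link `top p` is not the top link of another member of
`P`. So one needs a LARGE family `P` (here `#P = 3L⁴ − L³ − L² − L` of the `6L⁴` plaquettes), an
injective rank `rk` on links and an assignment `top`, injective on `P`, with `top p` a link of `p` of maximal
rank among the four links of `p` (the links `(x, μ)`, `(x + e_μ, ν)`, `(x + e_ν, μ)`, `(x, ν)` of the
plaquette `p = (x; μ < ν)`, cf. `plaquetteHolonomy`).

**The construction** (vocabulary `Site`/`Edge`/`Plaquette`/`Site.shift` of `ConstructiveQFTWave0`; the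
file introduces NO definitions — the three objects are produced inside the proof).
* Rank `rk (x, μ) = c x + μ · L⁴`, where `c x = x₀ + x₁ L + x₂ L² + x₃ L³ < L⁴` reads the base point
  (coordinates as naturals `< L`, `ZMod.val`) as an `L`-adic integer (Mathlib's `finFunctionFinEquiv`,
  `TopLink.exists_coord`): direction-major, then positional in the base point; injective
  (`TopLink.rank_injective`).
* Family `P = {(x; μ < ν) : x ∈ B μ}`, where the box `B μ = ∏ᵢ slotᵢ` (`Fintype.piFinset`,
  `TopLink.exists_boxes`) consists of the base points with `x_{μ'} = 0` for all `μ' < μ` and `x_μ + 1 < L`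
  (as naturals, i.e. `x_μ ≠ L − 1`).
* Assignment `top (x; μ, ν) = (x + e_μ, ν)`.

**Checks.** (i) `top p` is the second listed link of `p`. (ii) Maximal rank (`TopLink.rank_le_rank_top`):
the links `(x, μ)` and `(x + e_ν, μ)` have direction `μ < ν`, so rank `< (μ + 1) L⁴ ≤ ν L⁴ ≤ rank (x + e_μ, ν)`;
and `c (x + e_μ) = c x + L^μ` because the `μ`-th coordinate does not wrap (`x_μ + 1 < L`), so
`rank (x, ν) ≤ rank (x + e_μ, ν)`. (iii) Injectivity on the family (`TopLink.injOn_top`): if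
`x + e_μ = x' + e_{μ'}` with `μ < μ'`, evaluate at `μ`: `x_μ + 1 = x'_μ = 0` in `ZMod L`, impossible without
wrap; so `μ = μ'`, cancel. (iv) Count (`TopLink.card_family`): `#B μ = ∏ᵢ #slotᵢ` with `#slotᵢ = 1`
(`i < μ`), `L − 1` (`i = μ`), `L` (`i > μ`), and `ν` ranges over `3 − μ` values:
`3 (L−1) L³ + 2 (L−1) L² + (L−1) L = 3L⁴ − L³ − L² − L`, stated additively.

Everything is proved from Mathlib (`ZMod`, `Fin`, `Finset.card`, `Fintype.piFinset`); no named facts, no new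
definitions. Helpers live in the sub-namespace `TopLink`.
-/

set_option autoImplicit false

noncomputable section

open Finset
open Literature.MathematicalPhysics.QuantumFieldTheory

namespace Summit.QuantumFields.YangMills.Theorems.FemtoCurvatureTwoPointC.TorusGauge

namespace TopLink

variable {L : ℕ}

/-! ## Arithmetic in `ZMod L` without wrap-around -/

/-- For `L ≥ 2` the residue `1 : ZMod L` has value `1`. -/
theorem val_one_of_two_le (hL : 2 ≤ L) : (1 : ZMod L).val = 1 := by
  rw [ZMod.val_one_eq_one_mod, Nat.mod_eq_of_lt hL]

/-- No wrap-around: if `a.val + 1 < L` then `(a + 1).val = a.val + 1`. -/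
theorem val_add_one_of_lt (hL : 2 ≤ L) {a : ZMod L} (ha : a.val + 1 < L) :
    (a + 1).val = a.val + 1 := by
  have h1 : (1 : ZMod L).val = 1 := val_one_of_two_le hL
  rw [ZMod.val_add_of_lt (by rwa [h1]), h1]

/-- Coordinates of the shifted site `x + e_μ`. -/
theorem shift_apply (x : Site 4 L) (μ i : Fin 4) :
    x.shift μ i = x i + if i = μ then 1 else 0 := by
  simp [Site.shift, Pi.single_apply]

/-- Key step for injectivity: if `x + e_μ = y + e_ν` where `x_μ` does not wrap and `y_i = 0` for
`i < ν`, then `¬ μ < ν` (evaluate at `μ`: `x_μ + 1 = y_μ = 0` would wrap). -/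
theorem not_lt_of_shift_eq (hL : 2 ≤ L) {x y : Site 4 L} {μ ν : Fin 4} (hx : (x μ).val + 1 < L)
    (hy : ∀ i : Fin 4, i < ν → y i = 0) (h : x.shift μ = y.shift ν) : ¬μ < ν := by
  intro hlt
  have h1 := congrFun h μ
  rw [shift_apply, shift_apply, if_pos rfl, if_neg hlt.ne, add_zero, hy μ hlt] at h1
  have h2 := congrArg ZMod.val h1
  rw [val_add_one_of_lt hL hx, ZMod.val_zero] at h2
  exact Nat.succ_ne_zero _ h2

/-! ## The rank: direction-major, then the base point read as an `L`-adic integer -/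

/-- Links of direction `μ < ν` rank below every link of direction `ν`, for any base-point code
`c < L⁴`. -/
theorem rank_le_of_lt {c : Site 4 L → ℕ} (hlt : ∀ x, c x < L ^ 4) (z w : Site 4 L) {μ ν : Fin 4}
    (hμν : μ < ν) : c z + (μ : ℕ) * L ^ 4 ≤ c w + (ν : ℕ) * L ^ 4 := by
  have h1 : (μ : ℕ) + 1 ≤ ν := hμν
  calc c z + (μ : ℕ) * L ^ 4 ≤ L ^ 4 + (μ : ℕ) * L ^ 4 := Nat.add_le_add_right (hlt z).le _
    _ = ((μ : ℕ) + 1) * L ^ 4 := by ring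
    _ ≤ (ν : ℕ) * L ^ 4 := Nat.mul_le_mul_right _ h1
    _ ≤ c w + (ν : ℕ) * L ^ 4 := Nat.le_add_left _ _

/-- **Maximal rank.** If the base-point code `c < L⁴` grows by `L^μ` under a non-wrapping shift in
direction `μ`, then for a plaquette `p = (x; μ < ν)` whose `μ`-th coordinate does not wrap, every one of
its four links has rank `c · + dir · L⁴` at most that of the link `(x + e_μ, ν)`. -/
theorem rank_le_rank_top {c : Site 4 L → ℕ} (hlt : ∀ x, c x < L ^ 4)
    (hshift : ∀ (x : Site 4 L) (μ : Fin 4), (x μ).val + 1 < L → c (x.shift μ) = c x + L ^ (μ : ℕ))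
    {p : Plaquette 4 L} (hp : (p.1 p.2.1.1).val + 1 < L) :
    ∀ e ∈ ({(p.1, p.2.1.1), (p.1.shift p.2.1.1, p.2.1.2), (p.1.shift p.2.1.2, p.2.1.1),
      (p.1, p.2.1.2)} : Finset (Edge 4 L)),
      c e.1 + (e.2 : ℕ) * L ^ 4 ≤ c (p.1.shift p.2.1.1) + (p.2.1.2 : ℕ) * L ^ 4 := by
  obtain ⟨x, ⟨⟨μ, ν⟩, hμν⟩⟩ := p
  intro e he
  simp only [Finset.mem_insert, Finset.mem_singleton] at he
  rcases he with rfl | rfl | rfl | rfl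
  · exact rank_le_of_lt hlt x _ hμν
  · exact le_rfl
  · exact rank_le_of_lt hlt _ _ hμν
  · show c x + (ν : ℕ) * L ^ 4 ≤ c (x.shift μ) + (ν : ℕ) * L ^ 4
    rw [hshift x μ hp]
    exact Nat.add_le_add_right (Nat.le_add_right _ _) _

variable [NeZero L]

/-- **The base-point code.** There is an injective `c : Site → ℕ` with `c < L⁴` that grows by `L^μ`
under a non-wrapping shift in direction `μ`: `c x = x₀ + x₁ L + x₂ L² + x₃ L³` (coordinates read as
naturals `< L`; Mathlib's `finFunctionFinEquiv`). -/
theorem exists_coord (hL : 2 ≤ L) :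
    ∃ c : Site 4 L → ℕ, Function.Injective c ∧ (∀ x, c x < L ^ 4) ∧
      ∀ (x : Site 4 L) (μ : Fin 4), (x μ).val + 1 < L → c (x.shift μ) = c x + L ^ (μ : ℕ) := by
  obtain ⟨dg, hdg⟩ : ∃ dg : Site 4 L → Fin 4 → Fin L, ∀ x i, ((dg x i : Fin L) : ℕ) = (x i).val :=
    ⟨fun x i => ⟨(x i).val, ZMod.val_lt (x i)⟩, fun _ _ => rfl⟩
  have hdg_inj : Function.Injective dg := fun x y h =>
    funext fun i => ZMod.val_injective L (by rw [← hdg x i, ← hdg y i, h])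
  refine ⟨fun x => (finFunctionFinEquiv (dg x) : ℕ),
    fun _ _ h => hdg_inj (finFunctionFinEquiv.injective (Fin.ext h)),
    fun x => (finFunctionFinEquiv (dg x)).isLt, fun x μ hx => ?_⟩
  have key : ∀ i : Fin 4, (x.shift μ i).val = (x i).val + if i = μ then 1 else 0 := by
    intro i
    rw [shift_apply]
    by_cases h : i = μ
    · subst h
      rw [if_pos rfl, if_pos rfl]
      exact val_add_one_of_lt hL hx
    · rw [if_neg h, if_neg h, add_zero, add_zero]
  show (finFunctionFinEquiv (dg (x.shift μ)) : ℕ) = (finFunctionFinEquiv (dg x) : ℕ) + L ^ (μ : ℕ)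
  simp only [finFunctionFinEquiv_apply, hdg, key, add_mul, Finset.sum_add_distrib, ite_mul, one_mul,
    zero_mul, Finset.sum_ite_eq', Finset.mem_univ, if_true]

/-- **Injectivity of the rank** `rk (x, μ) = c x + μ L⁴` for an injective code `c < L⁴` (a mixed-radix
expansion). -/
theorem rank_injective {c : Site 4 L → ℕ} (hinj : Function.Injective c) (hlt : ∀ x, c x < L ^ 4) :
    Function.Injective fun e : Edge 4 L => c e.1 + (e.2 : ℕ) * L ^ 4 := by
  rintro ⟨x, μ⟩ ⟨y, ν⟩ h
  have hT : 0 < L ^ 4 := pow_pos (Nat.pos_of_ne_zero (NeZero.ne L)) 4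
  have hdiv : ∀ (z : Site 4 L) (k : ℕ), (c z + k * L ^ 4) / L ^ 4 = k := fun z k => by
    rw [Nat.add_mul_div_right _ _ hT, Nat.div_eq_of_lt (hlt z), zero_add]
  have hmod : ∀ (z : Site 4 L) (k : ℕ), (c z + k * L ^ 4) % L ^ 4 = c z := fun z k => by
    rw [Nat.add_mul_mod_self_right, Nat.mod_eq_of_lt (hlt z)]
  have hμν : (μ : ℕ) = ν := (hdiv x μ).symm.trans ((congrArg (· / L ^ 4) h).trans (hdiv y ν))
  have hxy : c x = c y := (hmod x μ).symm.trans ((congrArg (· % L ^ 4) h).trans (hmod y ν))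
  exact Prod.ext (hinj hxy) (Fin.ext hμν)

/-! ## The family: boxes of base points, injectivity of the assignment, and the count -/

/-- There are `L − 1` residues mod `L` other than `L − 1`. -/
theorem card_filter_val_succ_lt : (univ.filter fun a : ZMod L => a.val + 1 < L).card = L - 1 := by
  have hL : L - 1 < L := Nat.sub_one_lt (NeZero.ne L)
  have hc : ((L - 1 : ℕ) : ZMod L).val = L - 1 := ZMod.val_cast_of_lt hL
  have h : (univ.filter fun a : ZMod L => a.val + 1 < L) = univ.erase ((L - 1 : ℕ) : ZMod L) := by
    ext a
    simp only [Finset.mem_filter, Finset.mem_univ, true_and, Finset.mem_erase, and_true]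
    constructor
    · rintro h rfl
      rw [hc] at h
      omega
    · intro hne
      have h1 := ZMod.val_lt a
      have h2 : a.val ≠ L - 1 := fun h => hne (ZMod.val_injective L (h.trans hc.symm))
      omega
  rw [h, Finset.card_erase_of_mem (Finset.mem_univ _), Finset.card_univ, ZMod.card]

/-- **The boxes of base points.** For each first direction `μ` the base points `x` with `x_μ + 1 < L`
(as naturals) and `x_i = 0` for `i < μ` form a box (`Fintype.piFinset` of the slots `{0}` for `i < μ`,
`{a : a.val + 1 < L}` for `i = μ`, everything for `i > μ`) of size `∏ᵢ #slotᵢ`, `#slotᵢ ∈ {1, L − 1, L}`. -/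
theorem exists_boxes : ∃ B : Fin 4 → Finset (Site 4 L),
    (∀ (μ : Fin 4) (x : Site 4 L), x ∈ B μ ↔ (x μ).val + 1 < L ∧ ∀ i : Fin 4, i < μ → x i = 0) ∧
    ∀ μ : Fin 4, (B μ).card = ∏ i : Fin 4, (if i < μ then 1 else if i = μ then L - 1 else L) := by
  refine ⟨fun μ => Fintype.piFinset fun i => if i < μ then {0} else
      if i = μ then univ.filter (fun a : ZMod L => a.val + 1 < L) else univ, fun μ x => ?_, fun μ => ?_⟩
  · rw [Fintype.mem_piFinset]
    constructor
    · intro h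
      refine ⟨?_, fun i hi => ?_⟩
      · have hμ := h μ
        simp only [lt_self_iff_false, if_false, if_true, Finset.mem_filter, Finset.mem_univ,
          true_and] at hμ
        exact hμ
      · have := h i
        simp only [if_pos hi, Finset.mem_singleton] at this
        exact this
    · rintro ⟨h1, h2⟩ i
      split_ifs with hi hi'
      · exact Finset.mem_singleton.2 (h2 i hi)
      · subst hi'
        exact Finset.mem_filter.2 ⟨Finset.mem_univ _, h1⟩
      · exact Finset.mem_univ _
  · rw [Fintype.card_piFinset]
    refine Finset.prod_congr rfl fun i _ => ?_
    split_ifs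
    · rfl
    · exact card_filter_val_succ_lt
    · rw [Finset.card_univ, ZMod.card]

omit [NeZero L] in
/-- **Injectivity of the assignment** `(x; μ, ν) ↦ (x + e_μ, ν)` on the family of plaquettes whose base
point lies in the box of its first direction. -/
theorem injOn_top [Fintype (Site 4 L)] (hL : 2 ≤ L) {B : Fin 4 → Finset (Site 4 L)}
    (hB : ∀ (μ : Fin 4) (x : Site 4 L), x ∈ B μ ↔ (x μ).val + 1 < L ∧ ∀ i : Fin 4, i < μ → x i = 0) :
    Set.InjOn (fun p : Plaquette 4 L => (p.1.shift p.2.1.1, p.2.1.2))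
      ↑(univ.filter fun p : Plaquette 4 L => p.1 ∈ B p.2.1.1) := by
  rintro ⟨x, ⟨⟨μ, ν⟩, hμν⟩⟩ hx ⟨y, ⟨⟨μ', ν'⟩, hμν'⟩⟩ hy h
  simp only [Finset.coe_filter, Finset.mem_univ, true_and, Set.mem_setOf_eq, hB] at hx hy
  simp only [Prod.mk.injEq] at h
  obtain ⟨h1, rfl⟩ := h
  have hμ : μ = μ' :=
    le_antisymm (not_lt.1 (not_lt_of_shift_eq hL hy.1 hx.2 h1.symm))
      (not_lt.1 (not_lt_of_shift_eq hL hx.1 hy.2 h1))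
  subst hμ
  have hxy : x = y := add_right_cancel (h1 : x + Pi.single μ 1 = y + Pi.single μ 1)
  subst hxy
  rfl

/-- **Count.** If the box for first direction `μ` has `∏ᵢ #slotᵢ` elements (`1`, `L − 1`, `L` for
`i < μ`, `i = μ`, `i > μ`), the family has `3 (L−1) L³ + 2 (L−1) L² + (L−1) L = 3L⁴ − L³ − L² − L` members:
`#P + (L³ + L² + L) = 3L⁴`. -/
theorem card_family {B : Fin 4 → Finset (Site 4 L)}
    (hB : ∀ μ : Fin 4, (B μ).card = ∏ i : Fin 4, (if i < μ then 1 else if i = μ then L - 1 else L)) :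
    (univ.filter fun p : Plaquette 4 L => p.1 ∈ B p.2.1.1).card + (L ^ 3 + L ^ 2 + L) = 3 * L ^ 4 := by
  have h1 : (univ.filter fun p : Plaquette 4 L => p.1 ∈ B p.2.1.1).card =
      ∑ q : {q : Fin 4 × Fin 4 // q.1 < q.2},
        ∏ i : Fin 4, (if i < q.1.1 then 1 else if i = q.1.1 then L - 1 else L) := by
    calc (univ.filter fun p : Plaquette 4 L => p.1 ∈ B p.2.1.1).card
          = ∑ p : Plaquette 4 L, if p.1 ∈ B p.2.1.1 then 1 else 0 := Finset.card_filter _ _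
      _ = ∑ q : {q : Fin 4 × Fin 4 // q.1 < q.2}, ∑ x : Site 4 L, if x ∈ B q.1.1 then 1 else 0 :=
          Fintype.sum_prod_type_right _
      _ = ∑ q : {q : Fin 4 × Fin 4 // q.1 < q.2}, (B q.1.1).card :=
          Finset.sum_congr rfl fun q _ => by rw [Finset.sum_ite_mem_eq, Finset.card_eq_sum_ones]
      _ = _ := Finset.sum_congr rfl fun q _ => hB _
  rw [h1, ← Finset.sum_subtype (p := fun q : Fin 4 × Fin 4 => q.1 < q.2)
    (univ.filter fun q : Fin 4 × Fin 4 => q.1 < q.2) (fun _ => by simp)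
    (fun q : Fin 4 × Fin 4 => ∏ i : Fin 4, (if i < q.1 then 1 else if i = q.1 then L - 1 else L)),
    Finset.sum_filter]
  simp only [Fintype.sum_prod_type, Fin.sum_univ_four, Fin.prod_univ_four]
  simp
  obtain ⟨M, rfl⟩ : ∃ M, L = M + 1 := ⟨L - 1, (Nat.succ_pred_eq_of_ne_zero (NeZero.ne L)).symm⟩
  simp only [Nat.add_sub_cancel]
  ring

end TopLink

/-! ## The registered statement -/

/-- **Top-link assignment on the 4-torus.** For `L ≥ 2` there are a family `P` of `3L⁴ − L³ − L² − L` plaquettes, a map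
`top` assigning to each of them one of its four links, and an injective rank on links (direction-major, then
positional in the base-point coordinates `x₀, x₁, x₂, x₃` read as naturals) such that `top` is injective on `P` and
`top p` has maximal rank among the four links of `p`. (Take `rk (x, μ) = μL⁴ + x₀ + x₁L + x₂L² + x₃L³`,
`P = {(x; μ < ν) : x_μ ≠ L − 1, x_{μ'} = 0 ∀ μ' < μ}`, `top (x; μ, ν) = (x + e_μ, ν)`; see
`TopLink.exists_coord`, `TopLink.exists_boxes`, `TopLink.rank_injective`, `TopLink.injOn_top`,
`TopLink.card_family`, `TopLink.rank_le_rank_top`.) -/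
theorem torus_topLink_assignment : ∀ (L : ℕ) [NeZero L], 2 ≤ L →
    ∃ (P : Finset (Plaquette 4 L)) (top : Plaquette 4 L → Edge 4 L) (rk : Edge 4 L → ℕ),
      Function.Injective rk ∧ Set.InjOn top ↑P ∧ P.card + (L ^ 3 + L ^ 2 + L) = 3 * L ^ 4 ∧
      ∀ p ∈ P,
        top p ∈ ({(p.1, p.2.1.1), (p.1.shift p.2.1.1, p.2.1.2), (p.1.shift p.2.1.2, p.2.1.1), (p.1, p.2.1.2)} :
          Finset (Edge 4 L)) ∧
        ∀ e ∈ ({(p.1, p.2.1.1), (p.1.shift p.2.1.1, p.2.1.2), (p.1.shift p.2.1.2, p.2.1.1), (p.1, p.2.1.2)} :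
          Finset (Edge 4 L)), rk e ≤ rk (top p) := by
  intro L _ hL
  obtain ⟨c, hc_inj, hc_lt, hc_shift⟩ := TopLink.exists_coord (L := L) hL
  obtain ⟨B, hB_mem, hB_card⟩ := TopLink.exists_boxes (L := L)
  refine ⟨univ.filter fun p : Plaquette 4 L => p.1 ∈ B p.2.1.1, fun p => (p.1.shift p.2.1.1, p.2.1.2),
    fun e => c e.1 + (e.2 : ℕ) * L ^ 4, TopLink.rank_injective hc_inj hc_lt, TopLink.injOn_top hL hB_mem,
    TopLink.card_family hB_card, fun p hp => ⟨by simp, ?_⟩⟩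
  have hp' : (p.1 p.2.1.1).val + 1 < L := by
    simp only [Finset.mem_filter, Finset.mem_univ, true_and, hB_mem] at hp
    exact hp.1
  exact TopLink.rank_le_rank_top hc_lt hc_shift hp'

end Summit.QuantumFields.YangMills.Theorems.FemtoCurvatureTwoPointC.TorusGauge

end
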